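import Summits.BirchSwinnertonDyer.BirchSwinnertonDyer.Theorems.ManinLocalTwoThreeStevensNaturalTes75
import Summits.BirchSwinnertonDyer.BirchSwinnertonDyer.Theorems.ManinLocalTwoThreeCDivisionIntegralCDT
import Summits.BirchSwinnertonDyer.BirchSwinnertonDyer.Theorems.ManinLocalTwoThreeCDivisionNeronPeriodsModCDT
import Summits.BirchSwinnertonDyer.BirchSwinnertonDyer.Theorems.ManinLocalTwoThreeFreyTwistShapeConductorAtTwo
import Literature.NumberTheory.EllipticCurves.CuspFormLFunctionLevelConductorProofs
import HarnessLib

/-!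
# The spine of the cell's conditional result, factored through ONE lattice statement and a PRINT-LITERAL hypothesis
(route `ManinLocalTwoThree`; crux C2 `ManinOddAtFour` stmt-BirchSwinnertonDyer-22967, C3 stmt-…-22968, residual C5 stmt-…-22969, rung
stmt-…-22445; cell bsd-f2-manin, LEAD prover p1 gen 23; `--supports stmt-BirchSwinnertonDyer-22967`)

WHAT THIS FILE RECORDS.  In every landed closer of the route — `maninLocalTwoThree_maninOddAtFour_of_CDT` (C2), `CDivisionInt.maninPrimeToThreeAtNine_of_CDTInt`
(C3), `CDivisionInt.maninPrimeToAdditiveFiveLe_of_CDTInt` (C5), `maninLocalTwoThree_maninConstantOneRung_of_CDT_of_modularity` (rung) — the hypothesis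
`hCDT : CalegariDimitrovTang2025_unboundedDenominators` is consumed at exactly one place: `CDivisionInt.periodLatticeGamma1_le_neron_of_CDTInt hCDT D`, i.e.
STEVENS' INCLUSION `Λ₁(f) ⊆ Λ_W` for the datum at hand (an g45's row E-an-250 `CDivisionNeron.Gamma1PeriodsInNeronLattice`; by imc §41.8 it is Stevens 1989
Conjecture I ∧ II).  Hence the cell's theorem splits into two kernel-checked halves with a clean interface:

* §1 (NO analytic input; unconditional implications between elementary statements about one datum `D` with the lattice clause):
  `Λ₁(f) ⊆ Λ_W ⟹ |c₀| ≤ 2 ∧ (p ≥ 3 ⟹ p ∤ c₀)` (p3/p2, conjugation obstruction), and `Λ₁(f) ⊆ Λ_W ⟹ modularity ⟹ |c₀| = 1`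
  (`abs_maninConstant_eq_one_of_gamma1Periods_le_of_modularity`: the half-index world is excluded by THEOREM K♮ from the PROVED Stevens fact
  T-es-75♮ `StevensGalois.naturalTes75_holds`, PROPOSITION A and the Tate family at `2`); whence BY NAME
  `maninOddAtFour_of_gamma1PeriodsInNeronLattice : Gamma1PeriodsInNeronLattice → ManinOddAtFour` (C2; the item's own modularity binder is used, its three
  classical Manin-constant binders and even `4 ∣ N` are idle), `maninPrimeToThreeAtNine_of_…` (C3), `maninPrimeToAdditiveFiveLe_of_…` (C5, both modularity-free),
  `maninConstantOne_of_gamma1PeriodsInNeronLattice_of_modularity : Gamma1PeriodsInNeronLattice → exists_isNewformOf → ManinConstantOne` and the rung.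
* §2 (the ONLY analytic input, with a PRINT-LITERAL trust base): `gamma1PeriodsInNeronLattice_of_UDW : (∀ k, UnboundedDenominatorsWeight k) →
  Gamma1PeriodsInNeronLattice`.  `UnboundedDenominatorsWeight k` (`Rank1Residual/ManinAdditive/UDCKummerLine.lean`) transcribes Calegari–Dimitrov–Tang's
  Theorem 1 with nothing but `MDifferentiable`, the weight-`k` slash action, exponential growth of every `SL₂(ℤ)`-slash at `i∞` (= meromorphic at the cusps)
  and an integer `q`-series `Σ bₙ e^{2πinτ}` on `ℍ` — no Mathlib `ModularForm`/`qExpansion`/`strictPeriods` API in the trusted statement (the tree also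
  proves `UDWOfCDT.unboundedDenominatorsWeight_of_CDT : CalegariDimitrovTang2025_unboundedDenominators → ∀ k, UnboundedDenominatorsWeight k`, so either
  rendering may be trusted).  The proof is p2's integer `c`-division witness `CDivisionInt.exists_cDivisionWitnessInt` (Honda at the multiplier `1`:
  `x(exp_W(∫ f)) ∈ ℤ((q))`) + the `Γ₁`-Wohlfahrt kernel.
* §3 the compositions: `maninConstantOne_of_UDW_of_modularity : (∀ k, UnboundedDenominatorsWeight k) → exists_isNewformOf → ManinConstantOne`, the rung,
  C2/C3/C5 `_of_UDW`, and Stevens' `|c₁| = 1` for optimal `X₁(N)`-data `abs_maninConstant₁_eq_one_of_UDW`.  (Composing §3 with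
  `UDWOfCDT.unboundedDenominatorsWeight_of_CDT hCDT` returns p1 g22's landed `maninLocalTwoThree_maninConstantOne_of_CDT_of_modularity` — same statement, not
  restated here.)

HONEST FRAMING.  §1 and §2 are unconditional IMPLICATIONS; every row whose hypothesis is `Gamma1PeriodsInNeronLattice` (open, ⟸ UBD), `∀ k,
UnboundedDenominatorsWeight k` (Calegari–Dimitrov–Tang, J. Amer. Math. Soc. 38 (2025) Thm. 1 — PRINTED, statement-only here) or `exists_isNewformOf`
(modularity — PRINTED, statement-only here) is CONDITIONAL on it.  Nothing here closes C2/C3/the rung as filed; MANIN'S CONJECTURE IS NOT PROVED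
UNCONDITIONALLY; BSD IS NOT PROVED BY THIS.  No definitions, no named facts, no sorry.
[cite: CalegariDimitrovTang2025, Thm. 1 (arXiv:2109.09040 p. 3, verbatim; = JAMS Thm. 1.0.1)] [cite: Stevens1989, §2 (Conjectures I, II; Thm. 2.3)]
[cite: Stevens1982, §1.3 Thm. 1.3.1 (b)] [cite: Honda1970, Thm. 9] [cite: Wohlfahrt1964, Thm. 2] [cite: Manin1972, Prop. 1.4, §1.6]
-/

set_option autoImplicit false
-- lint-debt: the directory name repeats the summit name (sibling precedent `ManinLocalTwoThreeCDivisionIntegralCDT.lean`)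
set_option linter.dupNamespace false

noncomputable section

open scoped MatrixGroups ModularForm Manifold PeriodPair
open CongruenceSubgroup Complex
open WeierstrassCurve Literature.NumberTheory.EllipticCurves Literature.NumberTheory.EllipticCurves.ModularForms
open Literature.NumberTheory.Automorphic
open Summit.BirchSwinnertonDyer.Rank1Residual.ManinAdditive.UDCKummerLine

namespace Summit.BirchSwinnertonDyer.BirchSwinnertonDyer.Theorems.ManinLocalTwoThree.UBDSpine

/-! ## §1 Stevens' inclusion for one datum ⟹ the Manin constant is `±1` (given modularity); E-an-250 ⟹ C2, C3, C5, the leaf, the rung -/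

section OneDatum

variable {W₀ : WeierstrassCurve ℚ} [W₀.IsElliptic] {N : ℕ} [NeZero N]

omit [W₀.IsElliptic] in
/-- **`|c₀| ≤ 2` and `p ∤ c₀` for `p ≥ 3`, from the lattice clause and Stevens' inclusion alone** (fact-free; p3/p2 `KummerValues`, the conjugation
obstruction `Λ₁(f) ⊄ pΛ₀(f)` for `p ≥ 3`).  Recorded as one row. [cite: Stevens1989, §2] [cite: Manin1972, §1.6] -/
theorem natAbs_maninConstant_le_two_and_not_odd_dvd_of_gamma1Periods_le (D₀ : ModularParametrizationData W₀ N)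
    (hopt : ∀ z ∈ D₀.L.lattice, ∃ w ∈ periodLattice D₀.f, z = D₀.c * w)
    (hSI : ∀ z ∈ periodLatticeGamma1 D₀.f, z ∈ D₀.L.lattice) :
    D₀.maninConstant.natAbs ≤ 2 ∧ ∀ p : ℕ, 3 ≤ p → ¬ (p : ℤ) ∣ D₀.maninConstant :=
  ⟨KummerValues.natAbs_maninConstant_le_two_of_gamma1Periods_le D₀ hopt hSI,
    fun _ hp ↦ KummerValues.not_dvd_maninConstant_of_gamma1Periods_le D₀ hopt hSI hp⟩

/-- **`2 ∤ c₀` from Stevens' inclusion and modularity** (every level): `2 ∣ c₀` is the half-index world `Λ₁(f) ⊆ 2Λ₀(f)`, excluded by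
`NaturalTes75.not_halfIndex_of_modularity_naturalTes75` with the PROVED Stevens fact T-es-75♮ `StevensGalois.naturalTes75_holds`.  CONDITIONAL on
`exists_isNewformOf` only. [cite: Stevens1982, §1.3 Thm. 1.3.1 (b)] [cite: Stevens1989, §2] -/
theorem not_two_dvd_maninConstant_of_gamma1Periods_le_of_modularity (hnf : exists_isNewformOf) (D₀ : ModularParametrizationData W₀ N)
    (hopt : ∀ z ∈ D₀.L.lattice, ∃ w ∈ periodLattice D₀.f, z = D₀.c * w)
    (hSI : ∀ z ∈ periodLatticeGamma1 D₀.f, z ∈ D₀.L.lattice) : ¬ (2 : ℤ) ∣ D₀.maninConstant := fun h2 ↦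
  NaturalTes75.not_halfIndex_of_modularity_naturalTes75 StevensGalois.naturalTes75_holds hnf W₀ D₀ hopt
    (KummerValues.halfIndex_of_gamma1Periods_le_of_two_dvd D₀ hopt hSI h2)

/-- **`|c₀| = 1` for ONE lattice-optimal datum, from Stevens' inclusion for that datum and modularity** — the CDT-free half of the cell's theorem
(p2 g23's `NaturalTes75.abs_maninConstant_eq_one_of_modularity_CDT_naturalTes75` with `hSI` as a hypothesis instead of being produced from CDT).
CONDITIONAL on `exists_isNewformOf`; Manin's conjecture is NOT proved by this. [cite: Stevens1989, §2] [cite: Stevens1982, §1.3 Thm. 1.3.1 (b)] -/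
theorem abs_maninConstant_eq_one_of_gamma1Periods_le_of_modularity (hnf : exists_isNewformOf) (D₀ : ModularParametrizationData W₀ N)
    (hopt : ∀ z ∈ D₀.L.lattice, ∃ w ∈ periodLattice D₀.f, z = D₀.c * w)
    (hSI : ∀ z ∈ periodLatticeGamma1 D₀.f, z ∈ D₀.L.lattice) : |D₀.maninConstant| = 1 := by
  have hle := (natAbs_maninConstant_le_two_and_not_odd_dvd_of_gamma1Periods_le D₀ hopt hSI).1
  have hne : D₀.maninConstant.natAbs ≠ 0 := Int.natAbs_ne_zero.mpr D₀.maninConstant_ne_zero_holds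
  have hne2 : D₀.maninConstant.natAbs ≠ 2 := fun h2 ↦
    not_two_dvd_maninConstant_of_gamma1Periods_le_of_modularity hnf D₀ hopt hSI (Int.natAbs_dvd_natAbs.mp (by rw [h2]; decide))
  have h1 : D₀.maninConstant.natAbs = 1 := by omega
  rw [Int.abs_eq_natAbs, h1, Nat.cast_one]

end OneDatum

/-- **C2 `ManinOddAtFour` (stmt-BirchSwinnertonDyer-22967) BY NAME ⟸ E-an-250 `Gamma1PeriodsInNeronLattice`** (Stevens' inclusion for every `X₀(N)`-datum of a
globally minimal curve).  The item's own modularity binder is used; Mazur / Abbes–Ullmo / Česnavičius and `4 ∣ N` are idle.  CONDITIONAL on E-an-250 (open;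
⟸ UBD, §2); C2 is NOT closed by this. [cite: Stevens1989, §2] [cite: Stevens1982, §1.3 Thm. 1.3.1 (b)] -/
theorem maninOddAtFour_of_gamma1PeriodsInNeronLattice (hSI : CDivisionNeron.Gamma1PeriodsInNeronLattice) :
    Summit.BirchSwinnertonDyer.BirchSwinnertonDyer.Theses.ManinLocalTwoThree.ManinOddAtFour := by
  intro _ _ _ hnf W₀ _ _ N _ D₀ hopt _
  exact not_two_dvd_maninConstant_of_gamma1Periods_le_of_modularity hnf D₀ hopt
    (CDivisionNeron.periodLatticeGamma1_le_lattice_of_forall_gamma1 D₀ (hSI W₀ D₀))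

/-- **C3 `ManinPrimeToThreeAtNine` (stmt-BirchSwinnertonDyer-22968) BY NAME ⟸ E-an-250** (all four printed-fact binders idle; no modularity).
CONDITIONAL on E-an-250; C3 is NOT closed by this. [cite: Stevens1989, §2] [cite: LingOesterle1991, Thm. 6] -/
theorem maninPrimeToThreeAtNine_of_gamma1PeriodsInNeronLattice (hSI : CDivisionNeron.Gamma1PeriodsInNeronLattice) :
    Summit.BirchSwinnertonDyer.BirchSwinnertonDyer.Theses.ManinLocalTwoThree.ManinPrimeToThreeAtNine := by
  intro _ _ _ _ W₀ _ _ N _ D₀ hopt _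
  exact KummerValues.not_dvd_maninConstant_of_gamma1Periods_le D₀ hopt
    (CDivisionNeron.periodLatticeGamma1_le_lattice_of_forall_gamma1 D₀ (hSI W₀ D₀)) le_rfl

/-- **C5 `ManinPrimeToAdditiveFiveLe` (the declared residual, stmt-BirchSwinnertonDyer-22969) BY NAME ⟸ E-an-250** (no modularity).  CONDITIONAL on E-an-250.
[cite: Stevens1989, §2] -/
theorem maninPrimeToAdditiveFiveLe_of_gamma1PeriodsInNeronLattice (hSI : CDivisionNeron.Gamma1PeriodsInNeronLattice) :
    Summit.BirchSwinnertonDyer.BirchSwinnertonDyer.Theses.ManinLocalTwoThree.ManinPrimeToAdditiveFiveLe := by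
  intro _ _ _ _ W₀ _ _ N _ D₀ hopt p _ h5 _
  exact KummerValues.not_dvd_maninConstant_of_gamma1Periods_le D₀ hopt
    (CDivisionNeron.periodLatticeGamma1_le_lattice_of_forall_gamma1 D₀ (hSI W₀ D₀)) (by omega)

/-- **Manin's conjecture leaf `Rank1Residual.ManinConstant.ManinConstantOne` ⟸ E-an-250 ∧ modularity** — the CDT-free half of the cell's theorem for ALL
lattice-optimal data at once.  CONDITIONAL on E-an-250 (⟸ UBD) and `exists_isNewformOf`; MANIN'S CONJECTURE IS NOT PROVED UNCONDITIONALLY; BSD is not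
proved. [cite: Stevens1989, §2] [cite: Stevens1982, §1.3 Thm. 1.3.1 (b)] -/
theorem maninConstantOne_of_gamma1PeriodsInNeronLattice_of_modularity (hSI : CDivisionNeron.Gamma1PeriodsInNeronLattice)
    (hnf : exists_isNewformOf) : Summit.BirchSwinnertonDyer.Rank1Residual.ManinConstant.ManinConstantOne :=
  fun W₀ _ _ _ _ D₀ hopt ↦ abs_maninConstant_eq_one_of_gamma1Periods_le_of_modularity hnf D₀ hopt
    (CDivisionNeron.periodLatticeGamma1_le_lattice_of_forall_gamma1 D₀ (hSI W₀ D₀))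

/-- **The route's rung target `ManinConstantOneRung` (stmt-BirchSwinnertonDyer-22445) BY NAME ⟸ E-an-250 ∧ modularity.**  CONDITIONAL; the item stays OPEN
as filed. [cite: Stevens1989, §2] [cite: Stevens1982, §1.3 Thm. 1.3.1 (b)] -/
theorem maninConstantOneRung_of_gamma1PeriodsInNeronLattice_of_modularity (hSI : CDivisionNeron.Gamma1PeriodsInNeronLattice)
    (hnf : exists_isNewformOf) : Summit.BirchSwinnertonDyer.BirchSwinnertonDyer.Theses.ManinLocalTwoThree.ManinConstantOneRung :=
  fun W₀ _ _ _ _ D₀ hopt ↦ abs_maninConstant_eq_one_of_gamma1Periods_le_of_modularity hnf D₀ hopt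
    (CDivisionNeron.periodLatticeGamma1_le_lattice_of_forall_gamma1 D₀ (hSI W₀ D₀))

/-! ## §2 The one analytic input, print-literal: `(∀ k, UnboundedDenominatorsWeight k)` ⟹ E-an-250 (and its `X₁(N)` twin E-an-252) -/

/-- **Stevens' inclusion `Λ₁(f) ⊆ Λ_W` for ONE `X₀(N)`-datum of a globally minimal curve ⟸ the unbounded-denominators theorem in its print-literal rendering**
(`UnboundedDenominatorsWeight k` at the weight `k` of p2's integer `c`-division witness `12·℘_{Λ_W}(ℰ_f)·G·Δ^a`, whose `q`-series is integral by Honda at the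
multiplier `1`).  CONDITIONAL on the printed theorem. [cite: CalegariDimitrovTang2025, Thm. 1] [cite: Honda1970, Thm. 9] [cite: Wohlfahrt1964, Thm. 2] -/
theorem periodLatticeGamma1_le_neron_of_UDW (hUDW : ∀ k : ℤ, UnboundedDenominatorsWeight k)
    {W : WeierstrassCurve ℚ} [W.IsElliptic] [W.IsGloballyMinimal] {N : ℕ} [NeZero N] (D : ModularParametrizationData W N) :
    ∀ z ∈ periodLatticeGamma1 D.f, z ∈ D.L.lattice := by
  obtain ⟨k, F, hhol, hinv, hstab, hgrowth, hq⟩ := CDivisionInt.exists_cDivisionWitnessInt W D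
  exact CDivisionInt.periodLatticeGamma1_le_neron_of_cDivisionWitness_of_UDWInt D (hUDW k) hhol hinv hstab hgrowth hq

/-- **E-an-250 `CDivisionNeron.Gamma1PeriodsInNeronLattice` BY NAME ⟸ `(∀ k, UnboundedDenominatorsWeight k)`** — Stevens' Conjectures I ∧ II (imc §41.8) from
Calegari–Dimitrov–Tang's Theorem 1 transcribed literally.  CONDITIONAL on the printed theorem; Stevens' conjectures are NOT proved unconditionally.
[cite: CalegariDimitrovTang2025, Thm. 1] [cite: Stevens1989, §2] -/
theorem gamma1PeriodsInNeronLattice_of_UDW (hUDW : ∀ k : ℤ, UnboundedDenominatorsWeight k) : CDivisionNeron.Gamma1PeriodsInNeronLattice :=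
  fun _ _ _ _ _ D γ ↦ periodLatticeGamma1_le_neron_of_UDW hUDW D _ (cuspSymbol_mem_periodLatticeGamma1 D.f γ)

/-- **Stevens' inclusion for ONE `X₁(N)`-datum of a globally minimal curve ⟸ `(∀ k, UnboundedDenominatorsWeight k)`** (the `X₀(N)`-datum of the same curve
carries the integer witness, which transfers: p2's `CDivisionInt.cDivisionWitnessInt₁_of_datum`).  CONDITIONAL on the printed theorem.
[cite: CalegariDimitrovTang2025, Thm. 1] [cite: Stevens1989, §2] -/
theorem periodLatticeGamma1_le_neron₁_of_UDW (hUDW : ∀ k : ℤ, UnboundedDenominatorsWeight k)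
    {W : WeierstrassCurve ℚ} [W.IsElliptic] [W.IsGloballyMinimal] {N : ℕ} [NeZero N] (D₁ : Gamma1ParametrizationData W N) :
    ∀ z ∈ periodLatticeGamma1 D₁.f, z ∈ D₁.L.lattice := by
  obtain ⟨D⟩ := CDivision.nonempty_modularParametrizationData_of_gamma1 D₁
  obtain ⟨k, F, hhol, hinv, hstab, hgrowth, hq⟩ :=
    CDivisionInt.cDivisionWitnessInt₁_of_datum D₁ D (CDivisionInt.exists_cDivisionWitnessInt W D)
  exact CDivisionInt.periodLatticeGamma1_le_neron₁_of_cDivisionWitness_of_UDWInt D₁ (hUDW k) hhol hinv hstab hgrowth hq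

/-- **E-an-252 `CDivisionNeron.Gamma1PeriodsInNeronLattice₁` BY NAME ⟸ `(∀ k, UnboundedDenominatorsWeight k)`.**  CONDITIONAL on the printed theorem.
[cite: CalegariDimitrovTang2025, Thm. 1] [cite: Stevens1989, §2] -/
theorem gamma1PeriodsInNeronLattice₁_of_UDW (hUDW : ∀ k : ℤ, UnboundedDenominatorsWeight k) : CDivisionNeron.Gamma1PeriodsInNeronLattice₁ :=
  fun _ _ _ _ _ D₁ γ ↦ periodLatticeGamma1_le_neron₁_of_UDW hUDW D₁ _ (cuspSymbol_mem_periodLatticeGamma1 D₁.f γ)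

/-! ## §3 The compositions from the print-literal hypothesis -/

/-- **Manin's conjecture leaf ⟸ {UBD (print-literal), modularity}**: for every globally minimal `W/ℚ`, every level and every lattice-optimal `X₀(N)`-datum,
`|c₀| = 1`.  Trust base = the two typed statements `∀ k, UnboundedDenominatorsWeight k` (Calegari–Dimitrov–Tang 2025 Thm. 1) and `exists_isNewformOf`
(Wiles / Taylor–Wiles / BCDT) + the tree's definitions.  CONDITIONAL; MANIN'S CONJECTURE IS NOT PROVED UNCONDITIONALLY; BSD is not proved.
[cite: CalegariDimitrovTang2025, Thm. 1] [cite: DiamondShurman2005, Thm. 8.8.3] [cite: Stevens1982, §1.3 Thm. 1.3.1 (b)] -/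
theorem maninConstantOne_of_UDW_of_modularity (hUDW : ∀ k : ℤ, UnboundedDenominatorsWeight k) (hnf : exists_isNewformOf) :
    Summit.BirchSwinnertonDyer.Rank1Residual.ManinConstant.ManinConstantOne :=
  maninConstantOne_of_gamma1PeriodsInNeronLattice_of_modularity (gamma1PeriodsInNeronLattice_of_UDW hUDW) hnf

/-- **The rung `ManinConstantOneRung` (stmt-BirchSwinnertonDyer-22445) BY NAME ⟸ {UBD (print-literal), modularity}.**  CONDITIONAL; the item stays OPEN as
filed. [cite: CalegariDimitrovTang2025, Thm. 1] [cite: DiamondShurman2005, Thm. 8.8.3] -/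
theorem maninConstantOneRung_of_UDW_of_modularity (hUDW : ∀ k : ℤ, UnboundedDenominatorsWeight k) (hnf : exists_isNewformOf) :
    Summit.BirchSwinnertonDyer.BirchSwinnertonDyer.Theses.ManinLocalTwoThree.ManinConstantOneRung :=
  maninConstantOneRung_of_gamma1PeriodsInNeronLattice_of_modularity (gamma1PeriodsInNeronLattice_of_UDW hUDW) hnf

/-- **C2 `ManinOddAtFour` BY NAME ⟸ UBD (print-literal)** — the item's own modularity binder feeds §1.  CONDITIONAL on the printed theorem (statement-only
in the tree); C2 is NOT closed by this; BSD is not proved. [cite: CalegariDimitrovTang2025, Thm. 1] [cite: Stevens1982, §1.3 Thm. 1.3.1 (b)] -/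
theorem maninOddAtFour_of_UDW (hUDW : ∀ k : ℤ, UnboundedDenominatorsWeight k) :
    Summit.BirchSwinnertonDyer.BirchSwinnertonDyer.Theses.ManinLocalTwoThree.ManinOddAtFour :=
  maninOddAtFour_of_gamma1PeriodsInNeronLattice (gamma1PeriodsInNeronLattice_of_UDW hUDW)

/-- **C3 `ManinPrimeToThreeAtNine` BY NAME ⟸ UBD (print-literal).**  CONDITIONAL; C3 is NOT closed by this. [cite: CalegariDimitrovTang2025, Thm. 1] -/
theorem maninPrimeToThreeAtNine_of_UDW (hUDW : ∀ k : ℤ, UnboundedDenominatorsWeight k) :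
    Summit.BirchSwinnertonDyer.BirchSwinnertonDyer.Theses.ManinLocalTwoThree.ManinPrimeToThreeAtNine :=
  maninPrimeToThreeAtNine_of_gamma1PeriodsInNeronLattice (gamma1PeriodsInNeronLattice_of_UDW hUDW)

/-- **C5 `ManinPrimeToAdditiveFiveLe` BY NAME ⟸ UBD (print-literal).**  CONDITIONAL. [cite: CalegariDimitrovTang2025, Thm. 1] -/
theorem maninPrimeToAdditiveFiveLe_of_UDW (hUDW : ∀ k : ℤ, UnboundedDenominatorsWeight k) :
    Summit.BirchSwinnertonDyer.BirchSwinnertonDyer.Theses.ManinLocalTwoThree.ManinPrimeToAdditiveFiveLe :=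
  maninPrimeToAdditiveFiveLe_of_gamma1PeriodsInNeronLattice (gamma1PeriodsInNeronLattice_of_UDW hUDW)

/-- **Stevens' `|c₁| = 1` for every OPTIMAL `X₁(N)`-datum of a globally minimal curve ⟸ UBD (print-literal)** (no modularity; `Λ₁(f) ⊆ Λ_W = c₁Λ₁(f)`).
CONDITIONAL on the printed theorem; Stevens' conjecture is NOT proved unconditionally. [cite: CalegariDimitrovTang2025, Thm. 1] [cite: Stevens1989, §2] -/
theorem abs_maninConstant₁_eq_one_of_UDW (hUDW : ∀ k : ℤ, UnboundedDenominatorsWeight k)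
    {W : WeierstrassCurve ℚ} [W.IsElliptic] [W.IsGloballyMinimal] {N : ℕ} [NeZero N]
    (D₁ : Gamma1ParametrizationData W N) (hopt : D₁.IsOptimal) : |D₁.maninConstant| = 1 :=
  CDivisionNeron.abs_maninConstant₁_eq_one_of_gamma1Periods_le D₁ hopt (gamma1PeriodsInNeronLattice₁_of_UDW hUDW W D₁)

/-! ## §4 (APPEND, p1 g23) Modularity enters only as «level = conductor at 2»: the leaf ⟸ {UBD (print-literal), Carayol} — an g47 §B, def-free

an g47 (MEMO-an §92 (B), Sketch-an-g47.lean 7df3bf08c630b021, T-an-g47-1) observed that `exists_isNewformOf` is consumed at ONE site of the rung cone —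
`KummerDiamond.freyTwistShapeTwoAdicLaw_of_local` (level 2-part = conductor 2-part) — and re-threaded the rung through E-es-186
`KummerDiamond.FreyTwistShapeTwoAdicLaw` and Carayol's level theorem.  Recorded here WITHOUT an's new definition `LevelTwoPartEqConductorTwoPart`
(the tree's named fact `IsNewformOf.level_eq_conductorNorm`, Carayol 1986, is used by name at every level instead), and composed with §2's
print-literal UBD hypothesis.  Since `IsNewformOf.level_eq_conductorNorm_of_exists_isNewformOf'` derives Carayol from `exists_isNewformOf` in the
tree, these rows have WEAKER hypotheses than §3's (and §3's `maninConstantOne_of_UDW_of_modularity` is recovered from `maninConstantOne_of_UDW_of_carayol`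
by `fun _ _ ↦ IsNewformOf.level_eq_conductorNorm_of_exists_isNewformOf' hnf` — same statement, not restated).  CONDITIONAL; nothing is closed; BSD is not proved. -/

/-- **E-es-186 `FreyTwistShapeTwoAdicLaw` ⟸ Carayol's level theorem (tree fact, by name, every level)** — with the PROVED local law E-es-186♭
`FreyTwistConductor.freyTwistShapeConductorExponentTwoLaw_holds` (Tate's algorithm on the Frey-twist family: `f₂ = 4`).  an g47's
`freyTwistShapeTwoAdicLaw_of_levelTwoPart ∘ levelTwoPart_of_carayol`, def-free.  CONDITIONAL on Carayol. [cite: Carayol1986] [cite: SilvermanATAEC1994, IV.9.4] -/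
theorem freyTwistShapeTwoAdicLaw_of_carayol (hcar : ∀ (N : ℕ) [NeZero N], IsNewformOf.level_eq_conductorNorm (N := N)) :
    Summit.BirchSwinnertonDyer.Rank1Residual.ManinAdditive.KummerDiamond.FreyTwistShapeTwoAdicLaw := by
  intro W₀ _ N _ D₀ hshape h32
  have hN : N = W₀.conductorNorm ℤ := hcar N D₀.isNewformOf
  have hf : (W₀.conductorNorm ℤ).factorization 2 = 4 := FreyTwistConductor.freyTwistShapeConductorExponentTwoLaw_holds W₀ hshape
  have h5 : 5 ≤ N.factorization 2 := (Nat.Prime.pow_dvd_iff_le_factorization Nat.prime_two (NeZero.ne N)).mp h32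
  rw [hN, hf] at h5
  omega

/-- **No lattice-optimal datum is in the half-index world `Λ₁(f) ⊆ 2Λ₀(f)` ⟸ E-es-186 alone** (Kummer values from the PROVED T-es-75♮; an g47's
`not_halfIndex_of_twoAdicLaw`, verbatim).  CONDITIONAL on E-es-186. [cite: Stevens1982, §1.3 Thm. 1.3.1 (b)] [cite: Stevens1989, §2] -/
theorem not_halfIndex_of_twoAdicLaw (h186 : Summit.BirchSwinnertonDyer.Rank1Residual.ManinAdditive.KummerDiamond.FreyTwistShapeTwoAdicLaw)
    (W₀ : WeierstrassCurve ℚ) [W₀.IsElliptic] {N : ℕ} [NeZero N]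
    (D₀ : ModularParametrizationData W₀ N) (hopt : ∀ z ∈ D₀.L.lattice, ∃ w ∈ periodLattice D₀.f, z = D₀.c * w)
    (hhalf : ∀ z ∈ periodLatticeGamma1 D₀.f, ∃ w ∈ periodLattice D₀.f, z = 2 * w) : False := by
  -- adapted verbatim from an g47 Sketch-an-g47.lean §B
  obtain ⟨h32, hshape⟩ := KummerValues.two_pow_five_dvd_and_hasFreyTwistShape_of_halfIndex_of_kummerValues W₀ D₀ hopt hhalf
    (NaturalTes75.halfIndex_kummerValues_of_naturalTes75 StevensGalois.naturalTes75_holds W₀ D₀ hhalf)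
  exact h186 W₀ D₀ hshape h32

/-- **`|c₀| = 1` for ONE lattice-optimal datum ⟸ Stevens' inclusion for it ∧ E-es-186** (modularity-free form of §1's
`abs_maninConstant_eq_one_of_gamma1Periods_le_of_modularity`).  CONDITIONAL on E-es-186. [cite: Stevens1989, §2] -/
theorem abs_maninConstant_eq_one_of_gamma1Periods_le_of_twoAdicLaw
    (h186 : Summit.BirchSwinnertonDyer.Rank1Residual.ManinAdditive.KummerDiamond.FreyTwistShapeTwoAdicLaw)
    {W₀ : WeierstrassCurve ℚ} [W₀.IsElliptic] {N : ℕ} [NeZero N] (D₀ : ModularParametrizationData W₀ N)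
    (hopt : ∀ z ∈ D₀.L.lattice, ∃ w ∈ periodLattice D₀.f, z = D₀.c * w)
    (hSI : ∀ z ∈ periodLatticeGamma1 D₀.f, z ∈ D₀.L.lattice) : |D₀.maninConstant| = 1 := by
  have hle := (natAbs_maninConstant_le_two_and_not_odd_dvd_of_gamma1Periods_le D₀ hopt hSI).1
  have hne : D₀.maninConstant.natAbs ≠ 0 := Int.natAbs_ne_zero.mpr D₀.maninConstant_ne_zero_holds
  have hne2 : D₀.maninConstant.natAbs ≠ 2 := fun h2 ↦
    not_halfIndex_of_twoAdicLaw h186 W₀ D₀ hopt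
      (KummerValues.halfIndex_of_gamma1Periods_le_of_two_dvd D₀ hopt hSI (Int.natAbs_dvd_natAbs.mp (by rw [h2]; decide)))
  have h1 : D₀.maninConstant.natAbs = 1 := by omega
  rw [Int.abs_eq_natAbs, h1, Nat.cast_one]

/-- **Manin's conjecture leaf ⟸ E-an-250 ∧ E-es-186** (no modularity binder at all).  CONDITIONAL on both rows. [cite: Stevens1989, §2] -/
theorem maninConstantOne_of_gamma1PeriodsInNeronLattice_of_twoAdicLaw (hSI : CDivisionNeron.Gamma1PeriodsInNeronLattice)
    (h186 : Summit.BirchSwinnertonDyer.Rank1Residual.ManinAdditive.KummerDiamond.FreyTwistShapeTwoAdicLaw) :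
    Summit.BirchSwinnertonDyer.Rank1Residual.ManinConstant.ManinConstantOne :=
  fun W₀ _ _ _ _ D₀ hopt ↦ abs_maninConstant_eq_one_of_gamma1Periods_le_of_twoAdicLaw h186 D₀ hopt
    (CDivisionNeron.periodLatticeGamma1_le_lattice_of_forall_gamma1 D₀ (hSI W₀ D₀))

/-- **Manin's conjecture leaf ⟸ {UBD (print-literal), E-es-186}.**  CONDITIONAL. [cite: CalegariDimitrovTang2025, Thm. 1] [cite: Stevens1989, §2] -/
theorem maninConstantOne_of_UDW_of_twoAdicLaw (hUDW : ∀ k : ℤ, UnboundedDenominatorsWeight k)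
    (h186 : Summit.BirchSwinnertonDyer.Rank1Residual.ManinAdditive.KummerDiamond.FreyTwistShapeTwoAdicLaw) :
    Summit.BirchSwinnertonDyer.Rank1Residual.ManinConstant.ManinConstantOne :=
  maninConstantOne_of_gamma1PeriodsInNeronLattice_of_twoAdicLaw (gamma1PeriodsInNeronLattice_of_UDW hUDW) h186

/-- **Manin's conjecture leaf ⟸ {UBD (print-literal), Carayol's level theorem (tree fact by name)}** — the sharpest trust base the tree offers:
Calegari–Dimitrov–Tang Thm 1 transcribed literally, and «a newform attached to `W` has level `N_W`» (Carayol 1986; DS Thm 8.8.1); no existence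
half of modularity, no Mazur / Abbes–Ullmo / Česnavičius.  CONDITIONAL on the two printed statements; MANIN'S CONJECTURE IS NOT PROVED
UNCONDITIONALLY; BSD is not proved. [cite: CalegariDimitrovTang2025, Thm. 1] [cite: Carayol1986] -/
theorem maninConstantOne_of_UDW_of_carayol (hUDW : ∀ k : ℤ, UnboundedDenominatorsWeight k)
    (hcar : ∀ (N : ℕ) [NeZero N], IsNewformOf.level_eq_conductorNorm (N := N)) :
    Summit.BirchSwinnertonDyer.Rank1Residual.ManinConstant.ManinConstantOne :=
  maninConstantOne_of_UDW_of_twoAdicLaw hUDW (freyTwistShapeTwoAdicLaw_of_carayol hcar)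

/-- **The rung `ManinConstantOneRung` (stmt-BirchSwinnertonDyer-22445) BY NAME ⟸ {UBD (print-literal), Carayol}.**  CONDITIONAL; the item stays OPEN as
filed. [cite: CalegariDimitrovTang2025, Thm. 1] [cite: Carayol1986] -/
theorem maninConstantOneRung_of_UDW_of_carayol (hUDW : ∀ k : ℤ, UnboundedDenominatorsWeight k)
    (hcar : ∀ (N : ℕ) [NeZero N], IsNewformOf.level_eq_conductorNorm (N := N)) :
    Summit.BirchSwinnertonDyer.BirchSwinnertonDyer.Theses.ManinLocalTwoThree.ManinConstantOneRung :=
  fun W₀ _ _ _ _ D₀ hopt ↦ maninConstantOne_of_UDW_of_carayol hUDW hcar W₀ D₀ hopt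

end Summit.BirchSwinnertonDyer.BirchSwinnertonDyer.Theorems.ManinLocalTwoThree.UBDSpine

end
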